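import Summits.QuantumFields.YangMills.Theorems.FluctuationComparisonRegPrIntLS2BetaMinActionRegPrContinuousOn
import Summits.QuantumFields.YangMills.Theorems.FluctuationComparisonRegPrIntLS2BetaResidualGauge
import HarnessLib

/-!
# S2β · CLOSED GRAPH OF THE (8)-ARGMIN OVER THE WINDOW, and THE RESIDUAL-ORBIT DISTANCE JOINTLY CONTINUOUS IN FIELD AND BASE POINT
# (part 1 of the «continuity-of-the-minimal-orbit letter» of the `V`-compactness road GAP♮∘; part 2 = `…S2BetaMinimalOrbitContinuousOn`)

Cell `ym3-torus` (YM ladder rung R3 = continuum `SU(2)` Yang–Mills on the three-torus at fixed lattice data — a RUNG: NOT d = 4, NOT infinite volume,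
NOT a mass gap, NOT Clay).  Width seat `ym3-torus-px10` (gen 20), FILE C1 (sequel of ✓FILE A `…S2BetaMinActionRegPrContinuousOn` p811150); helper of the crux
`stmt-QuantumFields-20520` (`…Theses.UnitScaleTilt.FluctuationComparisonRegPrIntL`), `--supports … --as helper`, count-neutral, DEFINITION-FREE
(0 `def`, 0 `instance`, 0 `notation`, 0 `sorry`, default heartbeats).

WHY (px13 g21's remark on FILE A, desk (o7)).  The registered GAP♯∘ asks for a gap constant UNIFORM in the datum; the per-datum road (UV3-NODE §47–§52) gives one
constant per `(V, U₀)`.  Uniformising over the (relatively compact) interior window by compactness needs the gap functional lower semicontinuous in `V`, i.e.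
(FILE A §1 `lowerSemicontinuousWithinAt_of_isCompact`) two inputs: `m(V) = minActionRegPr V` continuous (✓FILE A) and THE MINIMAL ORBIT CONTINUOUS IN `V` (part 2,
built on this part).  Print has both inside Prop. 9 p.309 (analyticity of `U_k(V)`); the tree had no statement.

WHAT IS PROVED (letters of FILE A: `Thm1GlobalMinAt L a₀ a₁ B₃`, `0 < ε₁ ≤ a₁`, `B₃ε₁ < ε₀ ≤ a₀`, `2ε₀` (53)-admissible; `n < K`; window `W := {PlaqSmall ε₁}`).
* §1 ★★ `minimiser_of_tendsto` — **CLOSED GRAPH**: if `V_i → V₀` inside `W`, `U_i → U₀`, and eventually `U_i` is an (8)(`B₃ε₁`)-regular configuration over `V_i` with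
  `A(U_i) = m(V_i)`, then `U₀ ∈ regFibrePr ε₀ V₀` and `A(U₀) = m(V₀)` — `U₀` minimises over (6)(ε₀) at `V₀` (FILE A's continuity of `m`, the continuity of the descent on
  the closed (8)-class ✓`MinimiserPin.continuousAt_descendTo_of_plaqLe`, uniqueness of limits).
* §2 `continuous_orbitDistSq₃`, ★`continuous_iInf_orbitDistSq₂` — the residual-orbit distance `(U, U₀) ↦ ⨅_{w residual} Σ_ℓ dist1 (U ℓ · (w • U₀)ℓ⁻¹)²` (GAP♯∘'s letter,
  registry `Lines/semiclassical_s2beta.lean` :776–777) is JOINTLY continuous in the field AND the base point (compact residual set ✓`compactSpace_residualGauge`,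
  `IsCompact.continuous_sInf`; ✓`…S2BetaFibreTransport.continuous_iInf_orbitDistSq` was the fixed-base-point edition); `continuous_gaugeAct_residual`.  (Invariance under
  residual translation of the base point is ALREADY in the tree: ✓`…S2BetaGapOrbitOfTubeReg.iInf_orbitDistSq_gaugeAct_residual` — imported by part 2, not restated.)

HONEST.  Point-set topology over landed theorems; nothing of Bałaban's analysis is added; print's Prop. 9 (ANALYTIC dependence of the minimiser on the datum) is NOT
proved; GAP♮∘ ∕ GAP♯∘ as registered, EXW∘ at `L = 3`, DET-REP-B, H4ᶜ∘, LFR♯ᶜ∘, S2β, crux 20520, 19936, 19200 and `YM3TorusSU2` are NOT proved; no summit statement is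
proved by a helper; rung R3 = SU(2) YM₃ on T³ at fixed lattice data — NOT d = 4, NOT infinite volume, NOT a mass gap, NOT Clay; the Yang–Mills mass gap is NOT proved.
Axioms standard.

References: T. Bałaban, CMP **102** (1985) 277–309 [Balaban1985Variational] ((2)–(8) p.278, Thm 1 (8)–(10) p.279, Prop. 9 p.309); CMP **109** (1987) 249–301
[Balaban1987RG1] ((0.4) p.253, p.256 after (0.21)); CMP **98** (1985) 17–51 [Balaban1985Averaging] ((8) p.19, Prop. 2 p.26); C. Berge, *Espaces topologiques, fonctions
multivoques* (1959) Ch. VI §3.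
-/

set_option autoImplicit false

noncomputable section

namespace Summit.QuantumFields.YangMills.Theorems.FluctuationComparisonRegPrIntLS2BetaMinimiserClosedGraph

open Set Filter Topology
open scoped Matrix.Norms.L2Operator
open Literature.MathematicalPhysics.QuantumFieldTheory.Balaban1983to89
open Literature.MathematicalPhysics.QuantumFieldTheory.Balaban1983to89.T3ContinuumYM3Torus
open Literature.MathematicalPhysics.QuantumFieldTheory.Balaban1983to89.T3UnitLawDensityEML (ℰp)
open Literature.MathematicalPhysics.QuantumFieldTheory.Balaban1983to89.T3PrintedRegularMinimiser
  (RegPr DivSmall regFibrePr minActionRegPr mem_regFibrePr_iff minActionRegPr_le)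
open Literature.MathematicalPhysics.QuantumFieldTheory.Balaban1983to89.T3PrintedMinimiserExistence
  (Thm1GlobalMinAt regFibrePr_mono plaqSmall_of_le regThreshold_mono minActionRegPr_eq_of_isMinOn)
open Literature.MathematicalPhysics.QuantumFieldTheory.Balaban1983to89.T3RegularMinimiser (regThreshold regFibre regThreshold_pos)
open Literature.MathematicalPhysics.QuantumFieldTheory.Balaban1983to89.T3ConstrainedMinimiser (fibre)
open Literature.MathematicalPhysics.QuantumFieldTheory.Balaban1983to89.T3DescentFibreTower (mem_fibre_iff)
open Literature.MathematicalPhysics.QuantumFieldTheory.Balaban1983to89.T3TiltDescent (descendTo)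
open Literature.MathematicalPhysics.QuantumFieldTheory.Balaban1983to89.B10Eq27TorusAxialLog (toUField unitsField)
open Literature.MathematicalPhysics.QuantumFieldTheory.Balaban1983to89.B10Eq68TorusRegularity (covDivT)
open Literature.MathematicalPhysics.QuantumFieldTheory.Balaban1983to89.ExpMeanLog (deltaSU deltaSU_pos)
open Summit.QuantumFields.YangMills.BalabanUVNodes.N07DirectMethod (continuous_wilsonAction4 continuous_dist1_plaqHol isCompact_of_isClosed_cfg)
open Summit.QuantumFields.YangMills.Theorems.MinimiserPin (continuousAt_descendTo_of_plaqLe isClosed_plaqLe isClosed_divLe)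
open Summit.QuantumFields.YangMills.Theorems.FluctuationComparisonRegPrIntLS2BetaResidualGauge
  (compactSpace_residualGauge)
open Summit.QuantumFields.YangMills.Theorems.FluctuationComparisonRegPrIntLS2BetaMinActionRegPrContinuousOn (continuousOn_minActionRegPr)

/-! ## §1 ★★ Closed graph of the (8)-argmin correspondence over the window -/

section ClosedGraph

variable (F : T3Family)

/-- ★★ **CLOSED GRAPH**: limits of (8)(`B₃ε₁`)-regular minimisers over converging window data are (6)(`ε₀`)-minimisers over the limit datum.
[cite: Balaban1985Variational, Thm 1 (8) p.279 and Prop 9 p.309; folklore: Berge, upper hemicontinuity of the argmin] -/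
theorem minimiser_of_tendsto {L : ℕ} {a₀ a₁ B₃ : ℝ} (hT : Thm1GlobalMinAt L a₀ a₁ B₃) (hB₃ : 0 < B₃) (hF : F.L = L)
    {n K : ℕ} (hnK : n < K) {ε₁ ε₀ : ℝ} (hε₁ : 0 < ε₁) (hε₁a : ε₁ ≤ a₁) (hlo : B₃ * ε₁ < ε₀) (hhi : ε₀ ≤ a₀)
    (hr3 : (143 * ((((3 + 4 : ℕ) : ℝ)) ^ 2 / 4) ^ 2) * (2 * ε₀) ≤ 1 / 3)
    (hr2 : 2 * (2 * ε₀) ≤ 2 * deltaSU (Fin 2) / (((3 + 4) * F.L : ℕ) : ℝ) ^ 2)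
    {ι : Type*} {l : Filter ι} [l.NeBot]
    {Vs : ι → GaugeField (F.P n) 0 (Matrix.specialUnitaryGroup (Fin 2) ℂ)} {Us : ι → GaugeField (F.P K) 0 (Matrix.specialUnitaryGroup (Fin 2) ℂ)}
    {V₀ : GaugeField (F.P n) 0 (Matrix.specialUnitaryGroup (Fin 2) ℂ)} {U₀ : GaugeField (F.P K) 0 (Matrix.specialUnitaryGroup (Fin 2) ℂ)}
    (hV₀ : PlaqSmall ε₁ V₀) (hVs : ∀ᶠ i in l, PlaqSmall ε₁ (Vs i)) (hVt : Tendsto Vs l (𝓝 V₀)) (hUt : Tendsto Us l (𝓝 U₀))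
    (hreg : ∀ᶠ i in l, Us i ∈ regFibrePr F n K hnK.le (B₃ * ε₁) (Vs i))
    (hmin : ∀ᶠ i in l, wilsonAction4 (Us i) = minActionRegPr F n K hnK.le ε₀ (Vs i)) :
    U₀ ∈ regFibrePr F n K hnK.le ε₀ V₀ ∧ wilsonAction4 U₀ = minActionRegPr F n K hnK.le ε₀ V₀ := by
  haveI : T2Space (GaugeField (F.P n) 0 (Matrix.specialUnitaryGroup (Fin 2) ℂ)) :=
    inferInstanceAs (T2Space (PBond (F.P n) 0 → Matrix.specialUnitaryGroup (Fin 2) ℂ))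
  have hε₀ : 0 < ε₀ := (mul_pos hB₃ hε₁).trans hlo
  have hL0 : (0 : ℝ) < (F.L : ℝ) := by exact_mod_cast (show 0 < F.L by have := F.hL.2; omega)
  have hLinv : (0 : ℝ) < (F.L : ℝ)⁻¹ := inv_pos.mpr hL0
  -- the closed (8)-class
  set C : Set (GaugeField (F.P K) 0 (Matrix.specialUnitaryGroup (Fin 2) ℂ)) :=
    {U | ∀ p : Plaq (F.P K) 0, GaugeGroup.dist1 (GaugeField.plaqHol U p) ≤ regThreshold F n K (B₃ * ε₁)} ∩
      {U | ∀ b : PBond (F.P K) 0, ‖covDivT 1 (unitsField (toUField U)) b.dir b.src‖ ≤ (B₃ * ε₁) * ((F.L : ℝ)⁻¹) ^ (3 * (K - n))}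
    with hC_def
  have hCcl : IsClosed C := (isClosed_plaqLe F K _).inter (isClosed_divLe F K _)
  have hUsC : ∀ᶠ i in l, Us i ∈ C := by
    filter_upwards [hreg] with i hi
    obtain ⟨-, hpl, hdv⟩ := (mem_regFibrePr_iff F).mp hi
    exact ⟨fun p => (hpl p).le, fun b => (hdv b).le⟩
  have hU₀C : U₀ ∈ C := hCcl.mem_of_tendsto hUt hUsC
  -- `U₀ ∈ 𝔘_k(ε₀)` (strict inequality `B₃ε₁ < ε₀`)
  have hthr : regThreshold F n K (B₃ * ε₁) < regThreshold F n K ε₀ := by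
    show B₃ * ε₁ * ((F.L : ℝ)⁻¹) ^ (2 * (K - n)) < ε₀ * ((F.L : ℝ)⁻¹) ^ (2 * (K - n))
    exact mul_lt_mul_of_pos_right hlo (pow_pos hLinv _)
  have hdiv : (B₃ * ε₁) * ((F.L : ℝ)⁻¹) ^ (3 * (K - n)) < ε₀ * ((F.L : ℝ)⁻¹) ^ (3 * (K - n)) :=
    mul_lt_mul_of_pos_right hlo (pow_pos hLinv _)
  have hU₀reg : RegPr F n K ε₀ U₀ := ⟨fun p => (hU₀C.1 p).trans_lt hthr, fun b => (hU₀C.2 b).trans_lt hdiv⟩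
  -- the descent is continuous at `U₀`, so `D U₀ = lim D (Us i) = lim Vs i = V₀`
  have hπ : ContinuousAt (descendTo F ℰp n K hnK.le) U₀ :=
    continuousAt_descendTo_of_plaqLe F n K hnK.le hε₀ hr3 hr2 (regThreshold_mono F hlo.le) hU₀C.1
  have hπt : Tendsto (fun i => descendTo F ℰp n K hnK.le (Us i)) l (𝓝 (descendTo F ℰp n K hnK.le U₀)) := hπ.tendsto.comp hUt
  have hπeq : (fun i => descendTo F ℰp n K hnK.le (Us i)) =ᶠ[l] Vs := by
    filter_upwards [hreg] with i hi
    exact (mem_fibre_iff F ℰp).mp ((mem_regFibrePr_iff F).mp hi).1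
  have hfib : descendTo F ℰp n K hnK.le U₀ = V₀ := tendsto_nhds_unique (hπt.congr' hπeq) hVt
  -- the action: `A U₀ = lim A (Us i) = lim m (Vs i) = m V₀` (FILE A: `m` is continuous on the window)
  have hm : ContinuousWithinAt (minActionRegPr F n K hnK.le ε₀) {V | PlaqSmall ε₁ V} V₀ :=
    continuousOn_minActionRegPr F hT hB₃ hF hnK hε₁ hε₁a hlo hhi hr3 hr2 V₀ hV₀
  have hVtW : Tendsto Vs l (𝓝[{V | PlaqSmall ε₁ V}] V₀) := tendsto_nhdsWithin_iff.mpr ⟨hVt, hVs⟩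
  have hmt : Tendsto (fun i => minActionRegPr F n K hnK.le ε₀ (Vs i)) l (𝓝 (minActionRegPr F n K hnK.le ε₀ V₀)) := hm.tendsto.comp hVtW
  have hAt : Tendsto (fun i => wilsonAction4 (Us i)) l (𝓝 (wilsonAction4 U₀)) :=
    ((continuous_wilsonAction4 (N := 2)).tendsto U₀).comp hUt
  have hA : wilsonAction4 U₀ = minActionRegPr F n K hnK.le ε₀ V₀ := tendsto_nhds_unique (hAt.congr' hmin) hmt
  exact ⟨(mem_regFibrePr_iff F).mpr ⟨(mem_fibre_iff F ℰp).mpr hfib, hU₀reg⟩, hA⟩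

end ClosedGraph

/-! ## §2 The residual-orbit distance: joint continuity and invariance under residual translation of the base point -/

section OrbitDistance

variable (F : T3Family) {J K : ℕ} (hJK : J ≤ K)

/-- Joint continuity of `((U, U₀), w) ↦ Σ_ℓ dist1 (U ℓ · (w • U₀)ℓ⁻¹)²` on (fields × fields) × the residual set. [cite: Balaban1985Variational, Thm 1 (8)-(10) p.279] -/
theorem continuous_orbitDistSq₃ :
    Continuous fun p : (GaugeField (F.P K) 0 (Matrix.specialUnitaryGroup (Fin 2) ℂ) × GaugeField (F.P K) 0 (Matrix.specialUnitaryGroup (Fin 2) ℂ)) ×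
        {w : Site (F.P K) 0 → Matrix.specialUnitaryGroup (Fin 2) ℂ |
          ∀ U : GaugeField (F.P K) 0 (Matrix.specialUnitaryGroup (Fin 2) ℂ),
            descendTo F ℰp J K hJK (GaugeField.gaugeAct w U) = descendTo F ℰp J K hJK U} =>
      ∑ ℓ : PBond (F.P K) 0,
        dist1 (p.1.1 ℓ * ((GaugeField.gaugeAct (p.2 : Site (F.P K) 0 → Matrix.specialUnitaryGroup (Fin 2) ℂ) p.1.2) ℓ)⁻¹) ^ 2 := by
  refine continuous_finsetSum _ fun ℓ _ => ?_
  have hdist : Continuous (dist1 : Matrix.specialUnitaryGroup (Fin 2) ℂ → ℝ) :=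
    UnitaryModel.continuous_opDist1.comp (Literature.MathematicalPhysics.QuantumLattice.continuous_fundamentalRep (Fin 2))
  refine (hdist.comp ?_).pow 2
  have h1 : Continuous fun p : (GaugeField (F.P K) 0 (Matrix.specialUnitaryGroup (Fin 2) ℂ) ×
      GaugeField (F.P K) 0 (Matrix.specialUnitaryGroup (Fin 2) ℂ)) ×
      {w : Site (F.P K) 0 → Matrix.specialUnitaryGroup (Fin 2) ℂ |
        ∀ U : GaugeField (F.P K) 0 (Matrix.specialUnitaryGroup (Fin 2) ℂ),
          descendTo F ℰp J K hJK (GaugeField.gaugeAct w U) = descendTo F ℰp J K hJK U} => p.1.1 ℓ :=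
    (continuous_apply ℓ).comp (continuous_fst.comp continuous_fst)
  have hU₀ : Continuous fun p : (GaugeField (F.P K) 0 (Matrix.specialUnitaryGroup (Fin 2) ℂ) ×
      GaugeField (F.P K) 0 (Matrix.specialUnitaryGroup (Fin 2) ℂ)) ×
      {w : Site (F.P K) 0 → Matrix.specialUnitaryGroup (Fin 2) ℂ |
        ∀ U : GaugeField (F.P K) 0 (Matrix.specialUnitaryGroup (Fin 2) ℂ),
          descendTo F ℰp J K hJK (GaugeField.gaugeAct w U) = descendTo F ℰp J K hJK U} => p.1.2 ℓ :=
    (continuous_apply ℓ).comp (continuous_snd.comp continuous_fst)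
  have hval : Continuous fun p : (GaugeField (F.P K) 0 (Matrix.specialUnitaryGroup (Fin 2) ℂ) ×
      GaugeField (F.P K) 0 (Matrix.specialUnitaryGroup (Fin 2) ℂ)) ×
      {w : Site (F.P K) 0 → Matrix.specialUnitaryGroup (Fin 2) ℂ |
        ∀ U : GaugeField (F.P K) 0 (Matrix.specialUnitaryGroup (Fin 2) ℂ),
          descendTo F ℰp J K hJK (GaugeField.gaugeAct w U) = descendTo F ℰp J K hJK U} =>
      (p.2 : Site (F.P K) 0 → Matrix.specialUnitaryGroup (Fin 2) ℂ) :=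
    continuous_subtype_val.comp continuous_snd
  have h2 : Continuous fun p : (GaugeField (F.P K) 0 (Matrix.specialUnitaryGroup (Fin 2) ℂ) ×
      GaugeField (F.P K) 0 (Matrix.specialUnitaryGroup (Fin 2) ℂ)) ×
      {w : Site (F.P K) 0 → Matrix.specialUnitaryGroup (Fin 2) ℂ |
        ∀ U : GaugeField (F.P K) 0 (Matrix.specialUnitaryGroup (Fin 2) ℂ),
          descendTo F ℰp J K hJK (GaugeField.gaugeAct w U) = descendTo F ℰp J K hJK U} =>
      (GaugeField.gaugeAct (p.2 : Site (F.P K) 0 → Matrix.specialUnitaryGroup (Fin 2) ℂ) p.1.2) ℓ := by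
    show Continuous fun p : (GaugeField (F.P K) 0 (Matrix.specialUnitaryGroup (Fin 2) ℂ) ×
        GaugeField (F.P K) 0 (Matrix.specialUnitaryGroup (Fin 2) ℂ)) ×
        {w : Site (F.P K) 0 → Matrix.specialUnitaryGroup (Fin 2) ℂ |
          ∀ U : GaugeField (F.P K) 0 (Matrix.specialUnitaryGroup (Fin 2) ℂ),
            descendTo F ℰp J K hJK (GaugeField.gaugeAct w U) = descendTo F ℰp J K hJK U} =>
      (p.2 : Site (F.P K) 0 → Matrix.specialUnitaryGroup (Fin 2) ℂ) ℓ.src * p.1.2 ℓ *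
        ((p.2 : Site (F.P K) 0 → Matrix.specialUnitaryGroup (Fin 2) ℂ) ℓ.tgt)⁻¹
    exact (((continuous_apply ℓ.src).comp hval).mul hU₀).mul ((continuous_apply ℓ.tgt).comp hval).inv
  exact h1.mul h2.inv

/-- ★ **THE RESIDUAL-ORBIT DISTANCE IS JOINTLY CONTINUOUS IN THE FIELD AND THE BASE POINT**: `(U, U₀) ↦ ⨅_{w residual} Σ_ℓ dist1 (U ℓ · (w • U₀)ℓ⁻¹)²`
is continuous (compact residual set; `IsCompact.continuous_sInf`). [cite: Balaban1985Variational, Thm 1 (8)-(10) p.279] -/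
theorem continuous_iInf_orbitDistSq₂ :
    Continuous fun p : GaugeField (F.P K) 0 (Matrix.specialUnitaryGroup (Fin 2) ℂ) × GaugeField (F.P K) 0 (Matrix.specialUnitaryGroup (Fin 2) ℂ) =>
      ⨅ w : {w : Site (F.P K) 0 → Matrix.specialUnitaryGroup (Fin 2) ℂ |
          ∀ U : GaugeField (F.P K) 0 (Matrix.specialUnitaryGroup (Fin 2) ℂ),
            descendTo F ℰp J K hJK (GaugeField.gaugeAct w U) = descendTo F ℰp J K hJK U},
        ∑ ℓ : PBond (F.P K) 0,
          dist1 (p.1 ℓ * ((GaugeField.gaugeAct (w : Site (F.P K) 0 → Matrix.specialUnitaryGroup (Fin 2) ℂ) p.2) ℓ)⁻¹) ^ 2 := by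
  haveI := compactSpace_residualGauge F hJK
  have h := IsCompact.continuous_sInf (K := (univ : Set {w : Site (F.P K) 0 → Matrix.specialUnitaryGroup (Fin 2) ℂ |
      ∀ U : GaugeField (F.P K) 0 (Matrix.specialUnitaryGroup (Fin 2) ℂ),
        descendTo F ℰp J K hJK (GaugeField.gaugeAct w U) = descendTo F ℰp J K hJK U}))
    (f := fun (p : GaugeField (F.P K) 0 (Matrix.specialUnitaryGroup (Fin 2) ℂ) × GaugeField (F.P K) 0 (Matrix.specialUnitaryGroup (Fin 2) ℂ))
      (w : {w : Site (F.P K) 0 → Matrix.specialUnitaryGroup (Fin 2) ℂ |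
        ∀ U : GaugeField (F.P K) 0 (Matrix.specialUnitaryGroup (Fin 2) ℂ),
          descendTo F ℰp J K hJK (GaugeField.gaugeAct w U) = descendTo F ℰp J K hJK U}) =>
      ∑ ℓ : PBond (F.P K) 0,
        dist1 (p.1 ℓ * ((GaugeField.gaugeAct (w : Site (F.P K) 0 → Matrix.specialUnitaryGroup (Fin 2) ℂ) p.2) ℓ)⁻¹) ^ 2)
    isCompact_univ (continuous_orbitDistSq₃ F hJK)
  refine h.congr fun p => ?_
  rw [image_univ, sInf_range]

/-- The residual set acts continuously on a fixed field: `w ↦ w • U₀` is continuous. [cite: Balaban1985Averaging, (8) p.19] -/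
theorem continuous_gaugeAct_residual (U₀ : GaugeField (F.P K) 0 (Matrix.specialUnitaryGroup (Fin 2) ℂ)) :
    Continuous fun w : {w : Site (F.P K) 0 → Matrix.specialUnitaryGroup (Fin 2) ℂ |
        ∀ U : GaugeField (F.P K) 0 (Matrix.specialUnitaryGroup (Fin 2) ℂ),
          descendTo F ℰp J K hJK (GaugeField.gaugeAct w U) = descendTo F ℰp J K hJK U} =>
      GaugeField.gaugeAct (w : Site (F.P K) 0 → Matrix.specialUnitaryGroup (Fin 2) ℂ) U₀ := by
  refine continuous_pi fun ℓ => ?_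
  have hval : Continuous fun w : {w : Site (F.P K) 0 → Matrix.specialUnitaryGroup (Fin 2) ℂ |
      ∀ U : GaugeField (F.P K) 0 (Matrix.specialUnitaryGroup (Fin 2) ℂ),
        descendTo F ℰp J K hJK (GaugeField.gaugeAct w U) = descendTo F ℰp J K hJK U} =>
      (w : Site (F.P K) 0 → Matrix.specialUnitaryGroup (Fin 2) ℂ) := continuous_subtype_val
  show Continuous fun w : {w : Site (F.P K) 0 → Matrix.specialUnitaryGroup (Fin 2) ℂ |
      ∀ U : GaugeField (F.P K) 0 (Matrix.specialUnitaryGroup (Fin 2) ℂ),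
        descendTo F ℰp J K hJK (GaugeField.gaugeAct w U) = descendTo F ℰp J K hJK U} =>
    (w : Site (F.P K) 0 → Matrix.specialUnitaryGroup (Fin 2) ℂ) ℓ.src * U₀ ℓ * ((w : Site (F.P K) 0 → Matrix.specialUnitaryGroup (Fin 2) ℂ) ℓ.tgt)⁻¹
  exact (((continuous_apply ℓ.src).comp hval).mul continuous_const).mul ((continuous_apply ℓ.tgt).comp hval).inv

end OrbitDistance

end Summit.QuantumFields.YangMills.Theorems.FluctuationComparisonRegPrIntLS2BetaMinimiserClosedGraph

end
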